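/-
Soloist `solo-ValiantsHypothesis-informed`, session 17 — pair packing and the antichain count.
-/
import Mathlib

/-!
# Pair packing: families meeting pairwise in at most one point

This is the finite-combinatorial core of the ANTICHAIN COUNT in the width budget of the soloist
note `paper/quadspan.md` §7.10 (Lemma 7.47(v), used in Theorem 7.48): in the flag tree of a rank-3
family whose column reductions are pairwise distinct, two incomparable nodes share at most one alive
column (Lemma 7.47(i)), so the alive sets `A(N)` over an antichain of nodes form a family of subsets of
the `b` columns meeting pairwise in `≤ 1` element; hence `∑_N C(|A(N)|, 2) ≤ C(b, 2)` and an antichain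
of nodes all with `|A(N)| ≥ D` has at most `C(b,2) / C(D,2)` elements.  We prove exactly these two
statements for an arbitrary finite family of finsets of `Fin b`:

* `soloInformed_pairPacking` : pairwise intersections of size `≤ 1` ⟹ `∑ A ∈ 𝒜, C(|A|,2) ≤ C(b,2)`;
* `soloInformed_antichainCount` : if moreover every member has size `≥ D` then `|𝒜| · C(D,2) ≤ C(b,2)`.

The proof is the injection "2-subset of a member ↦ 2-subset of the ground set" (the 2-subset
determines the member).
-/

namespace Summit.ValiantsHypothesis.ValiantsHypothesis.Theorems

open Finset

/-- Pair packing: if the members of `𝒜` pairwise meet in at most one point then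
`∑ A ∈ 𝒜, (A.card).choose 2 ≤ b.choose 2`. -/
theorem soloInformed_pairPacking {b : ℕ} (𝒜 : Finset (Finset (Fin b)))
    (h : ∀ A ∈ 𝒜, ∀ B ∈ 𝒜, A ≠ B → (A ∩ B).card ≤ 1) :
    ∑ A ∈ 𝒜, A.card.choose 2 ≤ b.choose 2 := by
  classical
  have hdisj : ∀ A ∈ 𝒜, ∀ B ∈ 𝒜, A ≠ B →
      Disjoint (A.powersetCard 2) (B.powersetCard 2) := by
    intro A hA B hB hAB
    rw [Finset.disjoint_left]
    intro P hPA hPB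
    rw [Finset.mem_powersetCard] at hPA hPB
    have hsub : P ⊆ A ∩ B := Finset.subset_inter hPA.1 hPB.1
    have hle : P.card ≤ (A ∩ B).card := Finset.card_le_card hsub
    have h1 : (A ∩ B).card ≤ 1 := h A hA B hB hAB
    have h2 : P.card = 2 := hPA.2
    omega
  calc ∑ A ∈ 𝒜, A.card.choose 2
      = ∑ A ∈ 𝒜, (A.powersetCard 2).card := by
        refine Finset.sum_congr rfl ?_
        intro A _
        rw [Finset.card_powersetCard]
    _ = (𝒜.biUnion fun A => A.powersetCard 2).card := by
        rw [Finset.card_biUnion hdisj]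
    _ ≤ ((Finset.univ : Finset (Fin b)).powersetCard 2).card := by
        apply Finset.card_le_card
        intro P hP
        rw [Finset.mem_biUnion] at hP
        obtain ⟨A, _, hPA⟩ := hP
        rw [Finset.mem_powersetCard] at hPA ⊢
        exact ⟨Finset.subset_univ _, hPA.2⟩
    _ = b.choose 2 := by
        rw [Finset.card_powersetCard, Finset.card_univ, Fintype.card_fin]

/-- Antichain count: a family of `≥ D`-sets of `Fin b` meeting pairwise in at most one point has
`|𝒜| · C(D,2) ≤ C(b,2)`. -/
theorem soloInformed_antichainCount {b D : ℕ} (𝒜 : Finset (Finset (Fin b)))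
    (h : ∀ A ∈ 𝒜, ∀ B ∈ 𝒜, A ≠ B → (A ∩ B).card ≤ 1) (hD : ∀ A ∈ 𝒜, D ≤ A.card) :
    𝒜.card * D.choose 2 ≤ b.choose 2 := by
  calc 𝒜.card * D.choose 2 = ∑ _A ∈ 𝒜, D.choose 2 := by
        rw [Finset.sum_const, smul_eq_mul]
    _ ≤ ∑ A ∈ 𝒜, A.card.choose 2 :=
        Finset.sum_le_sum (fun A hA => Nat.choose_le_choose 2 (hD A hA))
    _ ≤ b.choose 2 := soloInformed_pairPacking 𝒜 h

end Summit.ValiantsHypothesis.ValiantsHypothesis.Theorems
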